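import Summits.QuantumFields.BalabanUV.T4Continuum.Support.ApproxRefineFillSmall
import Summits.QuantumFields.BalabanUV.T4Continuum.Support.SkeletonFillFullGradReduce

/-!
# T⁴ programme, node NE3 — kinematic refinement lemma, row R1-asm, part 3b: THE FLUX-GRADIENT CLAUSE OF THE FILLING
# REDUCED TO ROOT-CLOSENESS (`hfillG` of `approxRefine_of_gradBound` from row S4d's F4a `covGrad_fullFill_le_of_rootClose`
# ∘ part 2b's `rootData_precomp`, with the scale bookkeeping done)

NE3 formalisation swarm, LEAF PROVER 09 (unit `b2b-balaban-t4-ne3-formalise-leaf-09`), row **R1-asm**.  After part 3a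
(`ApproxRefineFillSmall.approxRefine_of_gradBound`, p213043) the socket `ApproxRefine` is open modulo ONE hypothesis, the
pointwise covariant flux-gradient bound of `W = fullFill L (precomp L U) (rootH L (precomp L U))`.  Row S4d's F4a
(`SkeletonFillFullGradReduce.covGrad_fullFill_le_of_rootClose`, leaf-04 g2, p212766) reduces that bound to the root data
`(a₀, δ)` and ONE number, the ROOT-CLOSENESS radius `ρ ≥ ‖W(∂p(L•z+q)) − h(z;μ,ν)‖` over all in-box `q` (F4b–F4d, pending,
supply `ρ` case by case).  THIS FILE does the remaining scale bookkeeping once and for all ([folklore]; 0 defs, 0 sorry):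
* `scale_fillG` — pure real arithmetic: F4a's `4(θ+θ_L)(a₀+ρ+δ) + 2(2ρ+δ)` at `a₀ = 4A/(L·s)²`, `δ ≤ 12G₀/(L²s³)`,
  `ρ ≤ r/s³` (`s = L^j ≥ 1`) is `≤ L³·(32dA(4A + r + 12G₀) + 4r + 24G₀)/(L·s)³`;
* **`covGrad_fill_of_rootClose`** — for a class-`j` regular `U` and a root-closeness radius `r/(L^j)³` of its filling:
  `‖(∇_W F)(x,κ;π)‖ ≤ c₁/(L^{j+1})³` with the CLOSED `c₁ = L³(32dA(4A + r + 12G₀) + 4r + 24G₀)`, `A = (8d−7)b`,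
  `G₀ = (2d−1)c + gradRem(d)b²`, under `4A + r + 12G₀ ≤ 1/2`;
* **`approxRefine_of_rootClose`** — `ApproxRefine d (sfClass d L N ε) L N b c b₁ c₁ m` with `b₁, c₁, m` CLOSED in
  `(d, L, b, c, r)`, MODULO the single scaled root-closeness hypothesis `hρ` (row S4d F4b–F4d deliver `ρ(a₀, δ, d, L)` with
  no term linear in `a₀`, whence `r`).

HONEST FRAMING.  No printed sentence is a hypothesis; everything imported BY NAME; no `def … : Prop`, no definition, no
`sorry`; axioms ⊆ {propext, Classical.choice, Quot.sound}.  NE3 NOT proved; `ApproxRefine` still CONDITIONAL on the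
root-closeness radius (row S4d F4b–F4d); spine 0/9; `BetaPertH`, (B), G-an2-4 occur nowhere; finite T⁴ rung (B)+1 — NOT
infinite volume, NOT a mass gap, NOT the Clay problem.  HONEST DEPENDENCY (cell page 1): continuum YM on T⁴ ⇐ BetaPertH ∧
nine spine estimates (0/9 proved); BetaPertH ⇐ (D1) ∧ (D4) ∧ CAP+tail; G-an2-4 gates asym, D1 and NE2/3/4.  PLACEMENT
(human rule 2026-08-19): under `Summits/QuantumFields/BalabanUV/`; imports tree modules only; moves nothing.
-/

set_option autoImplicit false

open scoped BigOperators Matrix Matrix.Norms.L2Operator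
open NormedSpace

namespace Summit.QuantumFields.BalabanUV.T4Continuum.ApproxRefineGradReduce

open Literature.MathematicalPhysics.QuantumFieldTheory.Balaban1983to89
open B7Prop1Explicit B7Prop2Explicit MatrixLog UnitaryModel
open T4AveragingDeficitWall hiding Site Plane Plaq Bond
open MinimalActionRate (sfClass)
open MinimalActionRefine (RegularSup)
open SkeletonFillUnitary (rootH rootCoeff rootCoeff_nonneg rootH_mem_unitary)
open SkeletonFillFull (fullFill InBox)
open SkeletonPrecomp (precomp precompCoeff)
open SkeletonPrecompGrad (gradRem gradRem_nonneg)
open SmoothRefineOfApprox (ApproxRefine)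
open ApproxRefineRootData (rootData_precomp)
open ApproxRefineAssembly (skeletonDatum_precomp_of_regularSup)
open ApproxRefineFillSmall (approxRefine_of_gradBound)
open SkeletonFillFullGradReduce (covGrad_fullFill_le_of_rootClose)

noncomputable section

variable {d : ℕ} {n : Type*} [Fintype n] [DecidableEq n]

/-! ## §1 Scale bookkeeping (pure real arithmetic) -/

/-- F4a's gradient constant at scaled root data: with `a₀ = L^{−2}·4A/s²`, `δ' ≤ 12L^{−2}G₀/s³`, `ρ ≤ r/s³`, `s ≥ 1`,
`L ≥ 1`, all of `A, G₀, r, δ', ρ ≥ 0`: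
`4(d(L−1)a₀ + d(L−1)La₀)(a₀+ρ+δ') + 2(2ρ+δ') ≤ L³(32dA(4A+r+12G₀) + 4r + 24G₀)/(L·s)³`. [folklore] -/
theorem scale_fillG (d L : ℕ) (hL : 1 ≤ L) {s A G₀ r ρ δ' : ℝ} (hs : 1 ≤ s) (hA : 0 ≤ A) (hG : 0 ≤ G₀) (hr : 0 ≤ r)
    (hρ0 : 0 ≤ ρ) (hρ : ρ ≤ r / s ^ 3) (hδ0 : 0 ≤ δ') (hδ : δ' ≤ 12 * rootCoeff L * (G₀ / s ^ 3)) :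
    4 * (d * ((L - 1 : ℕ) * (rootCoeff L * (4 * (A / s ^ 2)))) + d * (((L - 1 : ℕ) * L) * (rootCoeff L * (4 * (A / s ^ 2)))))
        * (rootCoeff L * (4 * (A / s ^ 2)) + ρ + δ') + 2 * (2 * ρ + δ')
      ≤ (L : ℝ) ^ 3 * (32 * d * A * (4 * A + r + 12 * G₀) + 4 * r + 24 * G₀) / ((L : ℝ) * s) ^ 3 := by
  have hL1 : (1 : ℝ) ≤ L := by exact_mod_cast hL
  have hL0 : (0 : ℝ) < L := by linarith
  have hs0 : 0 < s := by linarith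
  have hLm : ((L - 1 : ℕ) : ℝ) ≤ L := by exact_mod_cast Nat.sub_le L 1
  have hd0 : (0 : ℝ) ≤ d := by positivity
  have hrc : rootCoeff L = 1 / (L : ℝ) ^ 2 := by unfold rootCoeff; rw [one_div]
  have hrc1 : rootCoeff L ≤ 1 := SkeletonFillUnitary.rootCoeff_le_one hL
  have hrc0 : 0 ≤ rootCoeff L := rootCoeff_nonneg L
  set a₀ : ℝ := rootCoeff L * (4 * (A / s ^ 2)) with ha0def
  have ha00 : 0 ≤ a₀ := by positivity
  -- `1/s^3 ≤ 1/s^2`, `1/s^4 ≤ 1/s^3`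
  have hs32 : ∀ {X : ℝ}, 0 ≤ X → X / s ^ 3 ≤ X / s ^ 2 := fun hX =>
    div_le_div_of_nonneg_left hX (by positivity) (by nlinarith [pow_le_pow_right₀ hs (show 2 ≤ 3 by norm_num)])
  -- (i) `a₀ ≤ 4A/s²`
  have ha0le : a₀ ≤ 4 * A / s ^ 2 := by
    rw [ha0def]
    calc rootCoeff L * (4 * (A / s ^ 2)) ≤ 1 * (4 * (A / s ^ 2)) := by gcongr
      _ = 4 * A / s ^ 2 := by ring
  -- (ii) `θ + θ_L ≤ 2dL²a₀ ≤ 8dA·L²… ` but we keep `rootCoeff·L² = 1`: `d(L−1)a₀ + d(L−1)La₀ ≤ 2d·L²·a₀ = 8dA/s²`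
  have hθ : d * ((L - 1 : ℕ) * a₀) + d * (((L - 1 : ℕ) * L) * a₀) ≤ 8 * d * A / s ^ 2 := by
    have h1 : ((L - 1 : ℕ) : ℝ) * a₀ ≤ (L : ℝ) ^ 2 * a₀ := by
      apply mul_le_mul_of_nonneg_right _ ha00; nlinarith
    have h2 : (((L - 1 : ℕ) : ℝ) * L) * a₀ ≤ (L : ℝ) ^ 2 * a₀ := by
      apply mul_le_mul_of_nonneg_right _ ha00; nlinarith
    have hL2a : (L : ℝ) ^ 2 * a₀ = 4 * A / s ^ 2 := by rw [ha0def, hrc]; field_simp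
    calc d * ((L - 1 : ℕ) * a₀) + d * (((L - 1 : ℕ) * L) * a₀)
        ≤ d * ((L : ℝ) ^ 2 * a₀) + d * ((L : ℝ) ^ 2 * a₀) := by gcongr
      _ = 2 * d * (4 * A / s ^ 2) := by rw [hL2a]; ring
      _ = 8 * d * A / s ^ 2 := by ring
  -- (iii) `a₀ + ρ + δ' ≤ (4A + r + 12G₀)/s²`
  have hδle : δ' ≤ 12 * G₀ / s ^ 3 := by
    calc δ' ≤ 12 * rootCoeff L * (G₀ / s ^ 3) := hδ
      _ ≤ 12 * 1 * (G₀ / s ^ 3) := by gcongr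
      _ = 12 * G₀ / s ^ 3 := by ring
  have hsum : a₀ + ρ + δ' ≤ (4 * A + r + 12 * G₀) / s ^ 2 := by
    have h1 := hs32 hr
    have h2 := hs32 (show 0 ≤ 12 * G₀ by positivity)
    calc a₀ + ρ + δ' ≤ 4 * A / s ^ 2 + r / s ^ 3 + 12 * G₀ / s ^ 3 := by linarith
      _ ≤ 4 * A / s ^ 2 + r / s ^ 2 + 12 * G₀ / s ^ 2 := by linarith
      _ = (4 * A + r + 12 * G₀) / s ^ 2 := by ring
  have hsum0 : 0 ≤ a₀ + ρ + δ' := by positivity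
  -- (iv) the product term
  have hprod : 4 * (d * ((L - 1 : ℕ) * a₀) + d * (((L - 1 : ℕ) * L) * a₀)) * (a₀ + ρ + δ')
      ≤ 32 * d * A * (4 * A + r + 12 * G₀) / s ^ 3 := by
    have hθ0 : 0 ≤ d * ((L - 1 : ℕ) * a₀) + d * (((L - 1 : ℕ) * L) * a₀) := by positivity
    calc 4 * (d * ((L - 1 : ℕ) * a₀) + d * (((L - 1 : ℕ) * L) * a₀)) * (a₀ + ρ + δ')
        ≤ 4 * (8 * d * A / s ^ 2) * ((4 * A + r + 12 * G₀) / s ^ 2) := by gcongr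
      _ = 32 * d * A * (4 * A + r + 12 * G₀) / s ^ 4 := by field_simp; ring
      _ ≤ 32 * d * A * (4 * A + r + 12 * G₀) / s ^ 3 :=
          div_le_div_of_nonneg_left (by positivity) (by positivity)
            (by nlinarith [pow_le_pow_right₀ hs (show 3 ≤ 4 by norm_num)])
  -- (v) the linear term
  have hlin : 2 * (2 * ρ + δ') ≤ (4 * r + 24 * G₀) / s ^ 3 := by
    calc 2 * (2 * ρ + δ') ≤ 2 * (2 * (r / s ^ 3) + 12 * G₀ / s ^ 3) := by gcongr
      _ = (4 * r + 24 * G₀) / s ^ 3 := by ring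
  -- assemble: `X/s³ = L³X/(Ls)³`
  have hkey : (32 * d * A * (4 * A + r + 12 * G₀) / s ^ 3 + (4 * r + 24 * G₀) / s ^ 3)
      = (L : ℝ) ^ 3 * (32 * d * A * (4 * A + r + 12 * G₀) + 4 * r + 24 * G₀) / ((L : ℝ) * s) ^ 3 := by
    field_simp; ring
  calc _ ≤ 32 * d * A * (4 * A + r + 12 * G₀) / s ^ 3 + (4 * r + 24 * G₀) / s ^ 3 := add_le_add hprod hlin
    _ = _ := hkey

/-! ## §2 The flux-gradient clause from root-closeness -/

/-- **`hfillG` FROM ROOT-CLOSENESS**: for a class-`j` datum `U` with `RegularSup d L N b c j U` (`1 ≤ d`, `0 ≤ b, c`,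
`(d−1)b ≤ 1/32`, `(8d−7)b ≤ 1/4`) whose filling `W = fullFill L T h` (`T = precomp L U`, `h = rootH L T`) is ROOT-CLOSE
with radius `r/(L^j)³` (`‖W(∂p_{μν}(L•z+q)) − h(z;μ,ν)‖ ≤ r/(L^j)³` for in-box `q`, `μ < ν`), and
`4(8d−7)b + r + 12((2d−1)c + gradRem(d)b²) ≤ 1/2`: every covariant flux gradient of `W` is `≤ c₁/(L^{j+1})³` with
`c₁ = L³(32d(8d−7)b(4(8d−7)b + r + 12G₀) + 4r + 24G₀)`, `G₀ = (2d−1)c + gradRem(d)b²` — F4a at the root data of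
`rootData_precomp`, then §1. [folklore] -/
theorem covGrad_fill_of_rootClose [Nonempty n] (hd1 : 1 ≤ d) {L N : ℕ} (hL : 1 ≤ L) {b c r : ℝ} (hb : 0 ≤ b)
    (hc : 0 ≤ c) (hr : 0 ≤ r) (hdb : ((d : ℝ) - 1) * b ≤ 1 / 32) (hdT : (8 * (d : ℝ) - 7) * b ≤ 1 / 4)
    (hhalf : 4 * ((8 * (d : ℝ) - 7) * b) + r + 12 * ((2 * (d : ℝ) - 1) * c + gradRem d * b ^ 2) ≤ 1 / 2)
    {j : ℕ} {U : B7Prop1Explicit.Site d → Fin d → (Matrix n n ℂ)ˣ} (hreg : RegularSup d L N b c j U)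
    (hroot : ∀ (z q : B7Prop1Explicit.Site d) (μ ν : Fin d), μ < ν → InBox L q →
      ‖((hol (fullFill L (precomp L U) (rootH L (precomp L U))) ((L : ℤ) • z + q) (plaqWord μ ν) : (Matrix n n ℂ)ˣ) :
          Matrix n n ℂ) - ((rootH L (precomp L U) z μ ν : (Matrix n n ℂ)ˣ) : Matrix n n ℂ)‖ ≤ r / ((L : ℝ) ^ j) ^ 3)
    (x : B7Prop1Explicit.Site d) (κ : Fin d) (π : T4AveragingDeficitWall.Plane d) :
    ‖covGrad (fullFill L (precomp L U) (rootH L (precomp L U)))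
        (flux (fullFill L (precomp L U) (rootH L (precomp L U)))) x κ π‖
      ≤ (L : ℝ) ^ 3 * (32 * d * ((8 * (d : ℝ) - 7) * b)
            * (4 * ((8 * (d : ℝ) - 7) * b) + r + 12 * ((2 * (d : ℝ) - 1) * c + gradRem d * b ^ 2))
          + 4 * r + 24 * ((2 * (d : ℝ) - 1) * c + gradRem d * b ^ 2)) / ((L : ℝ) ^ (j + 1)) ^ 3 := by
  have hL1 : (1 : ℝ) ≤ L := by exact_mod_cast hL
  have hd1' : (1 : ℝ) ≤ d := by exact_mod_cast hd1
  obtain ⟨hTu, hTa, hTδ⟩ := rootData_precomp hL hreg.unitary hb j hreg.small hreg.grad hdb hdT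
  have hs1 : (1 : ℝ) ≤ (L : ℝ) ^ j := one_le_pow₀ hL1
  have hsmallT : (8 * (d : ℝ) - 7) * (b / ((L : ℝ) ^ j) ^ 2) ≤ 1 / 4 := by
    have h87 : 0 ≤ 8 * (d : ℝ) - 7 := by linarith
    calc (8 * (d : ℝ) - 7) * (b / ((L : ℝ) ^ j) ^ 2) ≤ (8 * (d : ℝ) - 7) * b := by
          apply mul_le_mul_of_nonneg_left (div_le_self hb (one_le_pow₀ hs1)) h87
      _ ≤ 1 / 4 := hdT
  have hD := skeletonDatum_precomp_of_regularSup (d := d) hL hb hreg hsmallT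
  have hA0 : 0 ≤ (8 * (d : ℝ) - 7) * b := mul_nonneg (by linarith) hb
  have hG0 : 0 ≤ (2 * (d : ℝ) - 1) * c + gradRem d * b ^ 2 :=
    add_nonneg (mul_nonneg (by linarith) hc) (mul_nonneg (gradRem_nonneg hd1) (sq_nonneg b))
  -- rewrite the root radius in the form `rootCoeff L * (4 * (A / s²))`
  have hTa' : ∀ (z : B7Prop1Explicit.Site d) (κ ν : Fin d), κ < ν →
      ‖((rootH L (precomp L U) z κ ν : (Matrix n n ℂ)ˣ) : Matrix n n ℂ) - 1‖
        ≤ rootCoeff L * (4 * ((8 * (d : ℝ) - 7) * b / ((L : ℝ) ^ j) ^ 2)) := hTa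
  have ha0 : 0 ≤ rootCoeff L * (4 * ((8 * (d : ℝ) - 7) * b / ((L : ℝ) ^ j) ^ 2)) :=
    mul_nonneg (rootCoeff_nonneg L) (mul_nonneg (by norm_num) (div_nonneg hA0 (by positivity)))
  have hδ0 : 0 ≤ 12 * rootCoeff L * (((2 * (d : ℝ) - 1) * c + gradRem d * b ^ 2) / ((L : ℝ) ^ j) ^ 3) :=
    mul_nonneg (mul_nonneg (by norm_num) (rootCoeff_nonneg L)) (div_nonneg hG0 (by positivity))
  have hρ0 : 0 ≤ r / ((L : ℝ) ^ j) ^ 3 := by positivity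
  -- smallness `a₀ + ρ + δ ≤ 1/2`
  have hscale := scale_fillG d L hL (A := (8 * (d : ℝ) - 7) * b) (G₀ := (2 * (d : ℝ) - 1) * c + gradRem d * b ^ 2)
    hs1 hA0 hG0 hr hρ0 le_rfl hδ0 le_rfl
  have hsmall : rootCoeff L * (4 * ((8 * (d : ℝ) - 7) * b / ((L : ℝ) ^ j) ^ 2)) + r / ((L : ℝ) ^ j) ^ 3
      + 12 * rootCoeff L * (((2 * (d : ℝ) - 1) * c + gradRem d * b ^ 2) / ((L : ℝ) ^ j) ^ 3) ≤ 1 / 2 := by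
    have hrc1 : rootCoeff L ≤ 1 := SkeletonFillUnitary.rootCoeff_le_one hL
    have hrc0 : 0 ≤ rootCoeff L := rootCoeff_nonneg L
    have hs3 : (1 : ℝ) ≤ ((L : ℝ) ^ j) ^ 3 := one_le_pow₀ hs1
    have hs2 : (1 : ℝ) ≤ ((L : ℝ) ^ j) ^ 2 := one_le_pow₀ hs1
    have e1 : rootCoeff L * (4 * ((8 * (d : ℝ) - 7) * b / ((L : ℝ) ^ j) ^ 2)) ≤ 4 * ((8 * (d : ℝ) - 7) * b) := by
      calc rootCoeff L * (4 * ((8 * (d : ℝ) - 7) * b / ((L : ℝ) ^ j) ^ 2))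
          ≤ 1 * (4 * ((8 * (d : ℝ) - 7) * b)) := by
            gcongr; exact div_le_self hA0 hs2
        _ = _ := one_mul _
    have e2 : r / ((L : ℝ) ^ j) ^ 3 ≤ r := div_le_self hr hs3
    have e3 : 12 * rootCoeff L * (((2 * (d : ℝ) - 1) * c + gradRem d * b ^ 2) / ((L : ℝ) ^ j) ^ 3)
        ≤ 12 * ((2 * (d : ℝ) - 1) * c + gradRem d * b ^ 2) := by
      calc 12 * rootCoeff L * (((2 * (d : ℝ) - 1) * c + gradRem d * b ^ 2) / ((L : ℝ) ^ j) ^ 3)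
          ≤ 12 * 1 * ((2 * (d : ℝ) - 1) * c + gradRem d * b ^ 2) := by
            gcongr; exact div_le_self hG0 hs3
        _ = _ := by ring
    linarith
  have hG := covGrad_fullFill_le_of_rootClose (d := d) hL hTu
    (fun z κ ν => rootH_mem_unitary hTu z κ ν (hD.small_all z κ ν)) hTa' ha0 hTδ hδ0 hroot hsmall x κ π
  rw [show ((L : ℝ) ^ (j + 1)) = (L : ℝ) * (L : ℝ) ^ j by ring]
  have hA4 : (8 * (d : ℝ) - 7) * b / ((L : ℝ) ^ j) ^ 2 = ((8 * (d : ℝ) - 7) * b) / ((L : ℝ) ^ j) ^ 2 := rfl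
  exact hG.trans hscale

/-! ## §3 The socket modulo root-closeness only -/

/-- **LEAF R1 ASSEMBLED MODULO ROOT-CLOSENESS ONLY**: with `A = (8d−7)b`, `G₀ = (2d−1)c + gradRem(d)b²`,
`b₁ = 4A + 48dL²G₀ + 128(2d+1)²L²A²` (part 3a) and `c₁ = L³(32dA(4A + r + 12G₀) + 4r + 24G₀)` (§2):
`ApproxRefine d (sfClass d L N ε) L N b c b₁ c₁ (3(1280d(d+1)²(d+4)²L²b₁² + d(d+1)c₁ + (d−1)²(c + (37(d−1)+4)b²)))`
from the displayed `j`-uniform smallness and the SINGLE hypothesis `hρ`: the filling of the pre-compensated datum of every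
class-`j` regular `U` is root-close with radius `r/(L^j)³` (row S4d F4b–F4d). [folklore] -/
theorem approxRefine_of_rootClose [Nonempty n] (hd1 : 1 ≤ d) (L N : ℕ) (hL : 1 ≤ L) {ε b c r : ℝ}
    (hb : 0 ≤ b) (hc : 0 ≤ c) (hr : 0 ≤ r)
    (h16 : (8 * (d : ℝ) - 7) * b ≤ 1 / 16) (hdb : ((d : ℝ) - 1) * b ≤ 1 / 32)
    (hquarter : 2 * (precompCoeff L * (((d : ℝ) - 1) * c)) + 37 * (((d : ℝ) - 1) * b) ^ 2
      + 4 * b * (((d : ℝ) - 1) * b) ≤ 1 / 4)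
    (hhalf : 4 * ((8 * (d : ℝ) - 7) * b) + r + 12 * ((2 * (d : ℝ) - 1) * c + gradRem d * b ^ 2) ≤ 1 / 2)
    (h512 : 512 * (d + 1) * (d + 4) * (L : ℝ) ^ 2
      * (4 * (8 * (d : ℝ) - 7) * b + 48 * d * (L : ℝ) ^ 2 * ((2 * (d : ℝ) - 1) * c + gradRem d * b ^ 2)
        + 128 * (2 * (d : ℝ) + 1) ^ 2 * (L : ℝ) ^ 2 * ((8 * (d : ℝ) - 7) * b) ^ 2) ≤ 1)
    (hρ : ∀ (j : ℕ) (U : B7Prop1Explicit.Site d → Fin d → (Matrix n n ℂ)ˣ), U ∈ sfClass (d := d) L N ε j →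
      RegularSup d L N b c j U → ∀ (z q : B7Prop1Explicit.Site d) (μ ν : Fin d), μ < ν → InBox L q →
      ‖((hol (fullFill L (precomp L U) (rootH L (precomp L U))) ((L : ℤ) • z + q) (plaqWord μ ν) : (Matrix n n ℂ)ˣ) :
          Matrix n n ℂ) - ((rootH L (precomp L U) z μ ν : (Matrix n n ℂ)ˣ) : Matrix n n ℂ)‖ ≤ r / ((L : ℝ) ^ j) ^ 3) :
    ApproxRefine d (sfClass (d := d) (n := n) L N ε) L N b c
      (4 * (8 * (d : ℝ) - 7) * b + 48 * d * (L : ℝ) ^ 2 * ((2 * (d : ℝ) - 1) * c + gradRem d * b ^ 2)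
        + 128 * (2 * (d : ℝ) + 1) ^ 2 * (L : ℝ) ^ 2 * ((8 * (d : ℝ) - 7) * b) ^ 2)
      ((L : ℝ) ^ 3 * (32 * d * ((8 * (d : ℝ) - 7) * b)
            * (4 * ((8 * (d : ℝ) - 7) * b) + r + 12 * ((2 * (d : ℝ) - 1) * c + gradRem d * b ^ 2))
          + 4 * r + 24 * ((2 * (d : ℝ) - 1) * c + gradRem d * b ^ 2)))
      (3 * (1280 * d * ((d : ℝ) + 1) ^ 2 * ((d : ℝ) + 4) ^ 2 * (L : ℝ) ^ 2
          * (4 * (8 * (d : ℝ) - 7) * b + 48 * d * (L : ℝ) ^ 2 * ((2 * (d : ℝ) - 1) * c + gradRem d * b ^ 2)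
            + 128 * (2 * (d : ℝ) + 1) ^ 2 * (L : ℝ) ^ 2 * ((8 * (d : ℝ) - 7) * b) ^ 2) ^ 2
        + d * ((d : ℝ) + 1) * ((L : ℝ) ^ 3 * (32 * d * ((8 * (d : ℝ) - 7) * b)
            * (4 * ((8 * (d : ℝ) - 7) * b) + r + 12 * ((2 * (d : ℝ) - 1) * c + gradRem d * b ^ 2))
          + 4 * r + 24 * ((2 * (d : ℝ) - 1) * c + gradRem d * b ^ 2)))
        + ((d : ℝ) - 1) ^ 2 * (c + (37 * ((d : ℝ) - 1) + 4) * b ^ 2))) := by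
  have hd1' : (1 : ℝ) ≤ d := by exact_mod_cast hd1
  have hL1 : (1 : ℝ) ≤ L := by exact_mod_cast hL
  have hdT : (8 * (d : ℝ) - 7) * b ≤ 1 / 4 := h16.trans (by norm_num)
  have hA0 : 0 ≤ (8 * (d : ℝ) - 7) * b := mul_nonneg (by linarith) hb
  have hG0 : 0 ≤ (2 * (d : ℝ) - 1) * c + gradRem d * b ^ 2 :=
    add_nonneg (mul_nonneg (by linarith) hc) (mul_nonneg (gradRem_nonneg hd1) (sq_nonneg b))
  have hc₁ : 0 ≤ (L : ℝ) ^ 3 * (32 * d * ((8 * (d : ℝ) - 7) * b)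
      * (4 * ((8 * (d : ℝ) - 7) * b) + r + 12 * ((2 * (d : ℝ) - 1) * c + gradRem d * b ^ 2))
      + 4 * r + 24 * ((2 * (d : ℝ) - 1) * c + gradRem d * b ^ 2)) := by positivity
  exact approxRefine_of_gradBound hd1 L N hL hb hc hc₁ h16 hdb hquarter h512
    (fun j U _ hreg => covGrad_fill_of_rootClose hd1 hL hb hc hr hdb hdT hhalf hreg (hρ j U ‹_› hreg))

end

end Summit.QuantumFields.BalabanUV.T4Continuum.ApproxRefineGradReduce
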